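import Mathlib

/-!
# ω-census (tpp lane): the 5/9 TORUS THEOREM behind the pair wall of `ℤ_p ⋊ C3` — definitions, statement, refuted sharpenings

Contributed by the speedrun lane `tpp` (exhaustive TPP-capacity census of small groups, summit MatrixMultiplication), seat
`sr-tpp-search-g21` (2026-08-23: statement, refuted sharpenings, rungs; source `run/shared/lean/speedrun/tpp/sr-tpp-search-g21/lean/TorusFiveNinths.lean`
v3, sha256 `8237fc2d92f525da018bf20303f46b75014a145865ab49d50a67e7cb09da1723`, farm `lean check` rc 0), restyled for the tree by seat
`sr-tpp-search-g30` (2026-08-26: house-style header, a docstring on every declaration, the `@[conjecture]` tag dropped because the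
statement is now PROVED — `TorusDensity.Proof.fiveNinthsTorus` in `TorusFiveNinthsTheorem.lean`; statements unchanged).
Framing: lottery ticket; floor = certified bounds/negative ranges.  Nothing in this file is progress on `ω`; it records STRUCTURE of the small-group TPP census (lane documents `run/shared/lean/speedrun/tpp/STRUCTURE.md`, `WRITEUP-A.md`).

THE RELAXED TORUS PROBLEM (lane files `sr-tpp-search-g21/F1-STRUCTURE.md` §3, `STRUCTURE.md` C6″ / Q6).  On the twisted triangular
torus `ℤ_p = ℤ[ω]/(π)` (`ω ↦ u`, `u³ = 1`, `u ≠ 1`, `p ≡ 1 (mod 3)` prime) call `U ⊂ ℤ_p` VALID if every `x ∈ U` owns an up-face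
`{z, z+1, z+1+u} ∋ x` meeting `U` only in `x`.  The pair wall `P(p)` of the family `ℤ_p ⋊ C3` (largest `|B|` in a saturated pair-type
TPP triple `({a}C3, {c}C3, B·C3)`, predicate `PairLaw.PairSatTPP` of `PairWallFiveNinths.lean`) equals `max |B|` over VALID
`U = μ₃·B ∌ 0` — both directions are kernel theorems (`Proof.pair_to_torus` in `TorusPairBound.lean`, `Proof.transversal` in
`TorusTransversalEquiv.lean`) — so the torus statements below govern the typed pair bound `PairLaw.FiveNinthsPairBound` (C6″).

CONTENTS: definitions `upFace`, `ValidUp`, `touched`; the 5/9 torus statement `FiveNinthsTorus` (Q6 — PROVED in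
`TorusFiveNinthsTheorem.lean` by a kernel-checked discharging certificate; found earlier to hold for all valid sets of every torus
`ℤ_m × ℤ_n`, `m ≤ 11`, by exact transfer matrices, F1-STRUCTURE §3.9); two natural SHARPENINGS, both REFUTED here by kernel-checked
witnesses found by the lane's search tools (STRUCTURE.md NEG-12, NEG-14): L2′ `SharpFiveNinthsTorus` "`9|U| ≤ 5·#(up-faces meeting U)`"
(⟺ `f₃ ≤ f₂ + 3e`) fails in `ℤ_19`, and L2″ `HalfSharpFiveNinthsTorus` "`18|U| ≤ p + 9·#(up-faces meeting U)`" (⟺ `f₃ ≤ f₂ + 3e + f₀/2`)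
fails in `ℤ_61`; so any valid inequality `9|U| ≤ 5·#(faces met) + c·f₀` needs `c ≥ 3/4` (`threeQuarters_needed_61`; the theorem itself
is `c = 5`).  Kernel-checked rungs at `p = 7`.  No sorry; axioms: the standard three.
-/

namespace Summit.MatrixMultiplication.OmegaCensus.SpeedrunTPP.TorusDensity

/-- The up-face with base corner `z`: `{z, z+1, z+1+u}`. -/
def upFace (p : ℕ) (u z : ZMod p) : Finset (ZMod p) := {z, z + 1, z + 1 + u}

/-- `U` is VALID: every `x ∈ U` owns one of its three up-faces (base corners `x`, `x-1`, `x-1-u`)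
privately, i.e. that face meets `U` exactly in `{x}`. -/
def ValidUp (p : ℕ) (u : ZMod p) (U : Finset (ZMod p)) : Prop :=
  ∀ x ∈ U, ∃ z ∈ ({x, x - 1, x - 1 - u} : Finset (ZMod p)), upFace p u z ∩ U = {x}

/-- Validity is decidable (a bounded search over `U` and the three candidate base corners); used by the `decide` rungs below. -/
instance (p : ℕ) (u : ZMod p) (U : Finset (ZMod p)) : Decidable (ValidUp p u U) := by
  unfold ValidUp; infer_instance

/-- Base corners of the up-faces MEETING `U`: the face of `z` meets `U` iff `z ∈ U ∪ (U-1) ∪ (U-1-u)`.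
Its cardinality is `p − f₀` (f₀ = number of up-faces missing `U`). -/
def touched (p : ℕ) (u : ZMod p) (U : Finset (ZMod p)) : Finset (ZMod p) :=
  U ∪ U.image (fun x => x - 1) ∪ U.image (fun x => x - 1 - u)

/-- **Q6, the 5/9 torus statement** (relaxed problem, no μ₃-symmetry): a valid set has at most `5p/9` points.
PROVED: `TorusDensity.Proof.fiveNinthsTorus` (`TorusFiveNinthsTheorem.lean`, kernel-checked discharging certificate);
kept as a named `Prop` because the lane documents and the pair-wall files cite it by this name. -/
def FiveNinthsTorus : Prop :=
  ∀ p : ℕ, p.Prime → p % 3 = 1 → ∀ u : ZMod p, u ^ 3 = 1 → u ≠ 1 →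
    ∀ U : Finset (ZMod p), ValidUp p u U → 9 * U.card ≤ 5 * p

/-- L2′, the SHARP form (F1-STRUCTURE §3.8): `9|U| ≤ 5 · #(up-faces meeting U)`, i.e. `9|U| + 5 f₀ ≤ 5p`,
equivalently `f₃ ≤ f₂ + 3e` in the face notation.  It would imply `FiveNinthsTorus`, holds for every valid set of
Z_7 (`sharp_7`) and of Z_13 (exhaustive search), and for every valid set without side-2 all-U triangles (§3.8),
but it is FALSE from p = 19 on: `not_sharpFiveNinthsTorus` below (it also fails on the 6 × n torus and, via a
33-point planar patch, in Z_p for 271 of the 296 pairs (p, u) with 109 ≤ p < 2000). -/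
def SharpFiveNinthsTorus : Prop :=
  ∀ p : ℕ, p.Prime → p % 3 = 1 → ∀ u : ZMod p, u ^ 3 = 1 → u ≠ 1 →
    ∀ U : Finset (ZMod p), ValidUp p u U → 9 * U.card ≤ 5 * (touched p u U).card

/-- L2″, the HALF-SHARP form (STRUCTURE.md C8): `18|U| ≤ p + 9 · #(up-faces meeting U)`, equivalently
`f₃ ≤ f₂ + 3e + f₀/2`.  True for every valid set of every torus Z_m × Z_n with m ≤ 11 (tight iff 3 ∣ m) and
pre-registered as P-011 — and FALSE in Z_61: `not_halfSharpFiveNinthsTorus` below (found by simulated annealing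
ten minutes after registration). -/
def HalfSharpFiveNinthsTorus : Prop :=
  ∀ p : ℕ, p.Prime → p % 3 = 1 → ∀ u : ZMod p, u ^ 3 = 1 → u ≠ 1 →
    ∀ U : Finset (ZMod p), ValidUp p u U → 18 * U.card ≤ p + 9 * (touched p u U).card

/-- Refuting set for L2′ in Z_19 (u = 7): 9 points, 16 up-faces met, 9·9 = 81 > 80 = 5·16 (f = (3,9,3,4), e = 0;
exhaustively, max (f₃ − f₂ − 3e) over valid sets of Z_19 is exactly 1). -/
def U19 : Finset (ZMod 19) := {3, 4, 6, 11, 14, 15, 16, 17, 18}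

/-- `U19` is valid in `ℤ_19` (`u = 7`). -/
theorem valid_U19 : ValidUp 19 7 U19 := by
  decide

/-- `|U19| = 9`. -/
theorem card_U19 : U19.card = 9 := by
  decide

/-- `U19` meets exactly `16` of the `19` up-faces (`f₀ = 3`). -/
theorem touched_U19 : (touched 19 7 U19).card = 16 := by
  decide

/-- L2′ is false: in Z_19 with u = 7 the valid set `U19` has 9·|U| = 81 > 80 = 5·#(up-faces meeting U). -/
theorem not_sharpFiveNinthsTorus : ¬ SharpFiveNinthsTorus := by
  intro h
  have h1 := h 19 (by norm_num) (by decide) 7 (by decide) (by decide) U19 valid_U19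
  rw [card_U19, touched_U19] at h1
  omega

/-- Refuting set for L2″ in Z_61 (u = 13): 32 points, 57 up-faces met (f = (4,32,11,14), e = 0),
18·32 = 576 > 574 = 61 + 9·57; equivalently f₃ − f₂ − 3e = 3 > 2 = f₀/2. -/
def U61 : Finset (ZMod 61) :=
  {0, 1, 4, 10, 13, 14, 18, 19, 20, 21, 22, 23, 32, 33, 35, 36, 38, 39, 40, 41, 42, 43, 44, 46, 49, 51, 52,
   54, 55, 57, 58, 60}

set_option maxRecDepth 200000 in
/-- `U61` is valid in `ℤ_61` (`u = 13`). -/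
theorem valid_U61 : ValidUp 61 13 U61 := by
  decide

set_option maxRecDepth 200000 in
/-- `|U61| = 32`. -/
theorem card_U61 : U61.card = 32 := by
  decide

set_option maxRecDepth 200000 in
/-- `U61` meets exactly `57` of the `61` up-faces (`f₀ = 4`). -/
theorem touched_U61 : (touched 61 13 U61).card = 57 := by
  decide

/-- L2″ is false: in Z_61 with u = 13 the valid set `U61` has 18·|U| = 576 > 574 = p + 9·#(up-faces meeting U). -/
theorem not_halfSharpFiveNinthsTorus : ¬ HalfSharpFiveNinthsTorus := by
  intro h
  have h1 := h 61 (by norm_num) (by decide) 13 (by decide) (by decide) U61 valid_U61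
  rw [card_U61, touched_U61] at h1
  omega

/-- The same set shows that the coefficient of f₀ in any true inequality `9|U| ≤ 5·#(faces met) + c·f₀`
must be at least 3/4: here 9·32 − 5·57 = 3 and f₀ = 61 − 57 = 4. -/
theorem threeQuarters_needed_61 : 4 * (9 * U61.card - 5 * (touched 61 13 U61).card) = 3 * (61 - (touched 61 13 U61).card) := by
  rw [card_U61, touched_U61]

/-! ## Kernel-checked rungs at p = 7 (u = 2): the sharp inequality for ALL 128 subsets, the relaxed
optimum R(7) = 3 = ⌊5·7/9⌋ (F1-STRUCTURE §3.7), and its attainment. -/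

set_option maxRecDepth 200000 in
/-- At `p = 7`, `u = 2` the SHARP inequality L2′ holds for every valid set (all `2⁷` subsets, `decide`). -/
theorem sharp_7 : ∀ U : Finset (ZMod 7), ValidUp 7 2 U → 9 * U.card ≤ 5 * (touched 7 2 U).card := by
  decide

set_option maxRecDepth 200000 in
/-- The relaxed optimum at `p = 7`: every valid `U ⊂ ℤ_7` (`u = 2`) has `|U| ≤ 3 = ⌊5·7/9⌋`. -/
theorem relaxedMax_7 : ∀ U : Finset (ZMod 7), ValidUp 7 2 U → U.card ≤ 3 := by
  decide

/-- … and `3` is attained: `{1, 2, 4}` (the μ₃-orbit of `1`, `u = 2`) is valid. -/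
theorem relaxedAttained_7 : ValidUp 7 2 {1, 2, 4} := by
  decide

end Summit.MatrixMultiplication.OmegaCensus.SpeedrunTPP.TorusDensity
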